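import Summits.PneNP.PneNP.Theorems.WindowHam.Negative.InvariantDNF

/-!
# The canonical DNF is symmetric under every `f`-preserving permutation of the variables
# (negative-side support, crux `stmt-PneNP-2143`)

Continuation of `InvariantDNF.lean`: for `π : Equiv.Perm ι` with `f (x ∘ π) = f x`, the gate
permutation `σDnf f π` — `π` on the negation gates (in coordinates `σIn π`), `y ↦ y ∘ π⁻¹` on the
minterms (`σAs π`), identity on the disjunction — is an induced automorphism of `dnfCircuit f`
(`dnfCircuit_isInducedAut`); hence the DNF of a `Γ`-invariant function is `Γ`-symmetric
(`dnfCircuit_isVarSymmetric`, Dawar–Wilsenach's variable form; Anderson–Dawar 2017, Def. 6–7).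
-/

namespace Summit.PneNP.PneNP.Theorems.WindowHam.Negative

open Literature.Computability.Complexity

section DNF

variable {ι : Type*} [Fintype ι] [DecidableEq ι] (f : (ι → Bool) → Bool)

/-! ### Symmetry -/

variable (π : Equiv.Perm ι)

/-- The action of `π` on variable numbers. -/
noncomputable def σIn : Equiv.Perm (Fin (Fintype.card ι)) := (eIn ι).trans (π.trans (eIn ι).symm)

/-- The action of `π` on assignment numbers: `y ↦ y ∘ π⁻¹`. -/
noncomputable def σAs : Equiv.Perm (Fin (Fintype.card (ι → Bool))) :=
  (eAs ι).trans ((Equiv.arrowCongr π (Equiv.refl Bool)).trans (eAs ι).symm)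

omit [DecidableEq ι] in
/-- `σIn π` is `π` in coordinates. -/
@[simp] theorem eIn_σIn (a : Fin (Fintype.card ι)) : eIn ι (σIn π a) = π (eIn ι a) := by
  simp [σIn]

/-- `σAs π` is `y ↦ y ∘ π⁻¹` in coordinates. -/
theorem eAs_σAs (k : Fin (Fintype.card (ι → Bool))) :
    eAs ι (σAs π k) = fun i => eAs ι k (π.symm i) := by
  simp only [σAs, Equiv.trans_apply, Equiv.apply_symm_apply]
  funext i
  simp [Equiv.arrowCongr_apply]

omit [DecidableEq ι] in
/-- `σIn π⁻¹` inverts `σIn π`. -/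
theorem σIn_symm_apply (a : Fin (Fintype.card ι)) : σIn π.symm (σIn π a) = a := by
  apply (eIn ι).injective
  simp

/-- `σAs π⁻¹` inverts `σAs π`. -/
theorem σAs_symm_apply (k : Fin (Fintype.card (ι → Bool))) : σAs π.symm (σAs π k) = k := by
  apply (eAs ι).injective
  rw [eAs_σAs, eAs_σAs]
  funext i
  simp

/-- The induced map on gate numbers (as a total function on `ℕ`). -/
noncomputable def sfun (j : ℕ) : ℕ :=
  if h : j < Fintype.card ι then (σIn π ⟨j, h⟩ : ℕ)
  else if h2 : j - Fintype.card ι < Fintype.card (ι → Bool) then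
    Fintype.card ι + (σAs π ⟨j - Fintype.card ι, h2⟩ : ℕ)
  else j

/-- `sfun` on negation gates. -/
theorem sfun_of_lt {j : ℕ} (h : j < Fintype.card ι) : sfun π j = σIn π ⟨j, h⟩ := by
  unfold sfun
  rw [dif_pos h]

/-- `sfun` on minterms. -/
theorem sfun_mid (k : Fin (Fintype.card (ι → Bool))) :
    sfun π (Fintype.card ι + k) = Fintype.card ι + (σAs π k : ℕ) := by
  unfold sfun
  rw [dif_neg (by omega), dif_pos (by rw [Nat.add_sub_cancel_left]; exact k.2)]
  congr 3
  exact Fin.ext (Nat.add_sub_cancel_left _ _)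

/-- `sfun` beyond the minterm block is the identity. -/
theorem sfun_of_ge {j : ℕ} (h : Fintype.card ι + Fintype.card (ι → Bool) ≤ j) : sfun π j = j := by
  unfold sfun
  rw [dif_neg (by omega), dif_neg (by omega)]

/-- `sfun` fixes the disjunction. -/
theorem sfun_last : sfun π (Fintype.card ι + Fintype.card (ι → Bool)) =
    Fintype.card ι + Fintype.card (ι → Bool) :=
  sfun_of_ge π le_rfl

/-- Trichotomy of gate numbers. -/
theorem gate_cases (j : ℕ) :
    j < Fintype.card ι ∨ (∃ k : Fin (Fintype.card (ι → Bool)), j = Fintype.card ι + k) ∨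
      Fintype.card ι + Fintype.card (ι → Bool) ≤ j := by
  by_cases h : j < Fintype.card ι
  · exact Or.inl h
  · by_cases h2 : j - Fintype.card ι < Fintype.card (ι → Bool)
    · exact Or.inr (Or.inl ⟨⟨j - Fintype.card ι, h2⟩, (Nat.add_sub_cancel' (Nat.not_lt.1 h)).symm⟩)
    · exact Or.inr (Or.inr (by omega))

/-- `sfun π⁻¹` inverts `sfun π`. -/
theorem sfun_symm_sfun (j : ℕ) : sfun π.symm (sfun π j) = j := by
  rcases gate_cases (ι := ι) j with h | ⟨k, rfl⟩ | h
  · rw [sfun_of_lt π h, sfun_of_lt π.symm (σIn π ⟨j, h⟩).2, Fin.eta, σIn_symm_apply]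
  · rw [sfun_mid, sfun_mid, σAs_symm_apply]
  · rw [sfun_of_ge π h, sfun_of_ge π.symm h]

/-- `sfun` preserves the range of gate numbers. -/
theorem sfun_lt {j : ℕ} (hj : j < Fintype.card ι + Fintype.card (ι → Bool) + 1) :
    sfun π j < Fintype.card ι + Fintype.card (ι → Bool) + 1 := by
  rcases gate_cases (ι := ι) j with h | ⟨k, rfl⟩ | h
  · rw [sfun_of_lt π h]
    have := (σIn π ⟨j, h⟩).2
    omega
  · rw [sfun_mid]
    have := (σAs π k).2
    omega
  · rw [sfun_of_ge π h]
    exact hj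

/-- The induced permutation of the gates of the DNF. -/
noncomputable def σDnf : Equiv.Perm (Fin (dnfCircuit f).gates.length) where
  toFun j := ⟨sfun π j, (sfun_lt π (j.2.trans_eq (dnfCircuit_length f))).trans_eq
    (dnfCircuit_length f).symm⟩
  invFun j := ⟨sfun π.symm j, (sfun_lt π.symm (j.2.trans_eq (dnfCircuit_length f))).trans_eq
    (dnfCircuit_length f).symm⟩
  left_inv j := Fin.ext (sfun_symm_sfun π j)
  right_inv j := Fin.ext (by simpa using sfun_symm_sfun π.symm j)

/-- The gate relabelling induced by `σDnf` is `sfun`. -/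
theorem relabelGate_σDnf (k : ℕ) : Circuit.relabelGate (σDnf f π) k = sfun π k := by
  by_cases hk : k < (dnfCircuit f).gates.length
  · rw [Circuit.relabelGate_of_lt _ hk]
    rfl
  · rw [Circuit.relabelGate_of_le _ (Nat.not_lt.1 hk), sfun_of_ge]
    rw [dnfCircuit_length] at hk
    omega

/-- Relabelled minterm wires: the minterm of `y ∘ π⁻¹`, read through `σIn π`, is the relabelling
of the minterm of `y`. -/
theorem mintermArgs_comp (y : ι → Bool) :
    (mintermArgs (fun i => y (π.symm i))) ∘ (σIn π) =
      Circuit.relabelWire π (σDnf f π) ∘ mintermArgs y := by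
  funext a
  simp only [Function.comp_apply, mintermArgs, eIn_σIn, Equiv.symm_apply_apply]
  split_ifs with hy
  · rfl
  · rw [Circuit.relabelWire_inr, relabelGate_σDnf, sfun_of_lt π a.2]

variable {f π}

/-- **Every `f`-preserving permutation of the variables extends to an automorphism of the DNF.**
[folklore] -/
theorem dnfCircuit_isInducedAut (hf : ∀ x : ι → Bool, f (fun i => x (π i)) = f x) :
    (dnfCircuit f).IsInducedAut π (σDnf f π) := by
  have hinv : ∀ y : ι → Bool, f (fun i => y (π.symm i)) = f y := fun y => by
    rw [← hf (fun i => y (π.symm i))]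
    simp
  refine ⟨?_, fun j => ?_⟩
  · show Sum.inr (Circuit.relabelGate (σDnf f π) (Fintype.card ι + Fintype.card (ι → Bool))) = _
    rw [relabelGate_σDnf, sfun_last]
    rfl
  · have hjlt : (j : ℕ) < Fintype.card ι + Fintype.card (ι → Bool) + 1 :=
      j.2.trans_eq (dnfCircuit_length f)
    have hσj : ((σDnf f π j : Fin _) : ℕ) = sfun π j := rfl
    rw [Fin.getElem_fin, Fin.getElem_fin, dnfCircuit_getElem, dnfCircuit_getElem, hσj]
    rcases gate_cases (ι := ι) (j : ℕ) with h | ⟨k, hk⟩ | h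
    · -- negation layer
      rw [sfun_of_lt π h, dnfGateAt_of_lt f (σIn π ⟨j, h⟩).2, dnfGateAt_of_lt f h]
      refine ⟨rfl, ?_⟩
      simp [notGate]
    · -- minterm layer
      rw [hk, sfun_mid, dnfGateAt_mid, dnfGateAt_mid]
      refine ⟨rfl, ?_⟩
      show (List.ofFn (mintermArgs (eAs ι (σAs π k)))).Perm
        ((List.ofFn (mintermArgs (eAs ι k))).map (Circuit.relabelWire π (σDnf f π)))
      rw [List.map_ofFn, ← mintermArgs_comp, eAs_σAs]
      exact (Equiv.Perm.ofFn_comp_perm (σIn π) _).symm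
    · -- the output gate
      have hj : (j : ℕ) = Fintype.card ι + Fintype.card (ι → Bool) := by omega
      rw [hj, sfun_last, dnfGateAt_last]
      refine ⟨rfl, ?_⟩
      show (List.ofFn (orArgs f)).Perm ((List.ofFn (orArgs f)).map (Circuit.relabelWire π (σDnf f π)))
      have hmem : ∀ k, σAs π k ∈ accSet f ↔ k ∈ accSet f := fun k => by
        simp only [accSet, Finset.mem_filter, Finset.mem_univ, true_and]
        rw [eAs_σAs, hinv]
      let τ : Equiv.Perm (Fin (accSet f).card) :=
        ((accEquiv f).trans ((σAs π).subtypePerm hmem)).trans (accEquiv f).symm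
      have hτ : (orArgs f) ∘ τ = Circuit.relabelWire π (σDnf f π) ∘ orArgs f := by
        funext c
        simp only [Function.comp_apply, orArgs, Circuit.relabelWire_inr, relabelGate_σDnf]
        rw [sfun_mid]
        simp [τ]
      rw [List.map_ofFn, ← hτ]
      exact (Equiv.Perm.ofFn_comp_perm τ _).symm

/-- **The DNF of a `Γ`-invariant function is `Γ`-symmetric** (variable form). [folklore] -/
theorem dnfCircuit_isVarSymmetric {Γ : Set (Equiv.Perm ι)}
    (hf : ∀ π ∈ Γ, ∀ x : ι → Bool, f (fun i => x (π i)) = f x) :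
    (dnfCircuit f).IsVarSymmetric Γ :=
  fun π hπ => ⟨σDnf f π, dnfCircuit_isInducedAut (hf π hπ)⟩

end DNF

end Summit.PneNP.PneNP.Theorems.WindowHam.Negative
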